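import Summits.BirchSwinnertonDyer.BirchSwinnertonDyer.Theorems.EisensteinPrimesBSDpOnCellCTelescopeBranchGluedPseudoRep
import Summits.BirchSwinnertonDyer.BirchSwinnertonDyer.Theorems.EisensteinPrimesBSDpOnCellCTelescopeBranchIntegralFrame
import Literature.NumberTheory.EllipticCurves.PNewBranchRationalChart
import HarnessLib

/-!
# [telescope — width x2-p2 g25, 2026-08-30] Brick G5 of «(F) CONSTRUCTED IN TREE»: the Frobenius-currency Galois lattice of
T-An-2ᶠ EXISTS on every analytic chart with `ℚ_p`-rational members

Crux 4 `BSDpOnCellC` (stmt-BirchSwinnertonDyer-19034), line «telescope» v19; ʳ-chain (director (610); host map STATUS l.7169 / l.7197 (b);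
LEAD g7 `RCHAIN-SPEC-g7.md` §5–§6). From the glued non-degenerate Wiles pseudo-representation `Ψ` of G2/G2c
(`TelescopeBranchGluedPseudoRep.exists_gluedPseudoRep`): Wiles' lemma over `K = Frac ℤ_p⟦X⟧` (B1 `WilesPseudoRep.toRep`, entries
`a, x(·,s₀)/x₀, x(r₀,·), d`), the integral continuous frame of G3 (`TelescopeBranchIntegralFrame.exists_framedRep_powerSeries_padicInt`),
and reading off: `charpoly (π σ) = X² − tr Ψ(σ) X + det Ψ(σ)` (so the fibre identities of `Ψ` ARE (F-fib₀)/(F-fib_t)), and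
`π(ι) = 1` on inertia off `N` from `tr Ψ(gι) = tr Ψ(g)` by trace rigidity (#1 `map_eq_one_of_forall_trace_mul_eq` with B1
`adjoin_range_toRep_eq_top`) = (F-unr); (F-rat) is the hypothesis. Main results:

* `isFrobeniusBranchGaloisLattice_of_pseudoRep` — the algebraic passage `Ψ ↦ π` with `IsFrobeniusBranchGaloisLattice W p x D π`;
* `exists_frobeniusBranchGaloisLattice_of_chart` — **for `W/ℚ` minimal, `p` odd multiplicative, every chart `IsPNewBranchAnalyticChart W p ι j A x D`
  with `ℚ_p`-rational members carries `π : Γ_ℚ →ₜ* GL₂(ℤ_p⟦X⟧)` with `IsFrobeniusBranchGaloisLattice W p x D π`** — Hida 1986 Thm. 2.1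
  (2.2b)/(2.2c)∘(2.1b) on the chart, CONSTRUCTED (Wiles 1988 §2.2's method), no Hecke algebra, no residual irreducibility.

* `frobeniusGaloisLattice_of_rationalMembers` — **THE KERNEL BRIDGE `T-An-2ʳ → T-An-2ᶠ` BY NAME**:
  `hida1986_castella2020_exists_rationalMembers_on_pNewBranchChart → hida1986_castella2020_exists_frobeniusGaloisLattice_on_pNewBranchChart`
  (idea-12 g44's `PNewBranchRationalChart`, p780084; binders and analytic conjuncts pass through, `π` is constructed) — condition (iii)(1) of
  director (610) / host l.7171 for the v20 verb. With g43/g24's landed bridges ᶠ → ᴴ → ᵍ the whole Galois side of the cited fact is now tree.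

Helper toward crux 4 (`--supports`); closes NO registered stub (v19's `stub_assembledFactsF` is the cited T-An-2ᶠ itself; a v20 re-cut to
`stub_assembledFactsR` is the LEAD's registry verb under W-79); proves no summit statement; BSD is proved for no curve.
-/

noncomputable section

set_option autoImplicit false
set_option linter.dupNamespace false

open scoped MatrixGroups ModularForm NumberField PowerSeries.WithPiTopology Topology
open NumberField IsDedekindDomain Field CongruenceSubgroup Matrix UpperHalfPlane Filter PowerSeries
  Literature.NumberTheory.GaloisRepresentations
  Literature.NumberTheory.EllipticCurves
  Literature.NumberTheory.EllipticCurves.ModularForms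
  Literature.NumberTheory.EllipticCurves.GreenbergSelmer

namespace Summit.BirchSwinnertonDyer.BirchSwinnertonDyer.Theorems.TelescopeBranchFrobeniusLatticeOfChart

variable {p : ℕ} [Fact p.Prime]

/-- The quadratic `X² − C a X + C b` maps under a ring homomorphism `f` to `X² − C (f a) X + C (f b)`. [folklore] -/
theorem map_quadratic {R S : Type*} [CommRing R] [CommRing S] (f : R →+* S) (a b : R) :
    (Polynomial.X ^ 2 - Polynomial.C a * Polynomial.X + Polynomial.C b).map f =
      Polynomial.X ^ 2 - Polynomial.C (f a) * Polynomial.X + Polynomial.C (f b) := by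
  simp [Polynomial.map_sub, Polynomial.map_mul]

/-- **From the glued pseudo-representation to the Frobenius-currency lattice (RCHAIN-SPEC §5–§6, pure algebra).** Let `Ψ` be a Wiles
pseudo-representation of `(Γ_ℚ, c)` over `ℤ_p⟦X⟧` (`p` odd) with continuous `a, d, x(r₀,·), x(·,s₀)`, `x(r₀,s₀) ≠ 0`, inertia-invariant
trace off `N`, and fibre polynomials `X² − tr·X + det` equal at arithmetic Frobenii to `X² − a_ℓ(E)X + ℓ` (`X = 0`) and `X² − ι_t(a_ℓ(g_t))X +
ℓ^{k_t−1}` (`X = x_t`, in `ℚ̄_p`); let the members be `ℚ_p`-rational. Then Wiles' representation over `Frac ℤ_p⟦X⟧`, integrally framed,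
satisfies `IsFrobeniusBranchGaloisLattice W p x D`. [cite: Wiles1988, §2.2] [cite: Hida2000, Prop. 2.16] [cite: Hida1986, Thm. 2.1 (2.2b) (2.2c), §2 (2.1b)] -/
theorem isFrobeniusBranchGaloisLattice_of_pseudoRep (W : WeierstrassCurve ℚ) [W.IsElliptic] [W.IsGloballyMinimal] (hp : 2 < p)
    (x : ℕ → ℤ_[p]) (D : ℕ → Skinner2016.HidaCongruentForm W p 1) {c : absoluteGaloisGroup ℚ}
    (Ψ : WilesPseudoRep (absoluteGaloisGroup ℚ) (PowerSeries ℤ_[p]) c) (r₀ s₀ : absoluteGaloisGroup ℚ) (hx₀ : Ψ.x r₀ s₀ ≠ 0)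
    (ha : Continuous Ψ.a) (hd : Continuous Ψ.d) (hcl : Continuous fun g => Ψ.x r₀ g) (hcr : Continuous fun g => Ψ.x g s₀)
    (hunr : ∀ v : HeightOneSpectrum (𝓞 ℚ), ¬ ((Rat.HeightOneSpectrum.primesEquiv v : Nat.Primes) : ℕ) ∣ W.conductorNorm ℤ →
      ∀ 𝔓 ∈ v.primesAbove, ∀ σ ∈ 𝔓.inertia (absoluteGaloisGroup ℚ), ∀ g, Ψ.tr (g * σ) = Ψ.tr g)
    (hfib0 : ∀ v : HeightOneSpectrum (𝓞 ℚ), ¬ ((Rat.HeightOneSpectrum.primesEquiv v : Nat.Primes) : ℕ) ∣ W.conductorNorm ℤ →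
      ((Rat.HeightOneSpectrum.primesEquiv v : Nat.Primes) : ℕ) ≠ p →
      ∀ 𝔓 ∈ v.primesAbove, ∀ σ : absoluteGaloisGroup ℚ, IsArithFrobAt (𝓞 ℚ) σ 𝔓 →
        Polynomial.X ^ 2 - Polynomial.C (constantCoeff (Ψ.tr σ)) * Polynomial.X + Polynomial.C (constantCoeff (Ψ.det σ)) =
          Polynomial.X ^ 2
            - Polynomial.C (((W.frobeniusTrace ((Rat.HeightOneSpectrum.primesEquiv v : Nat.Primes) : ℕ) : ℤ) : ℤ_[p])) *
                Polynomial.X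
            + Polynomial.C ((((Rat.HeightOneSpectrum.primesEquiv v : Nat.Primes) : ℕ) : ℤ_[p])))
    (hfibt : ∀ (t : ℕ) (ht : ‖x t‖ < 1), ∀ v : HeightOneSpectrum (𝓞 ℚ),
      ¬ ((Rat.HeightOneSpectrum.primesEquiv v : Nat.Primes) : ℕ) ∣ W.conductorNorm ℤ →
      ((Rat.HeightOneSpectrum.primesEquiv v : Nat.Primes) : ℕ) ≠ p →
      ∀ 𝔓 ∈ v.primesAbove, ∀ σ : absoluteGaloisGroup ℚ, IsArithFrobAt (𝓞 ℚ) σ 𝔓 →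
        (Polynomial.X ^ 2 - Polynomial.C (evalHom (x t) ht (Ψ.tr σ)) * Polynomial.X +
            Polynomial.C (evalHom (x t) ht (Ψ.det σ))).map ((algebraMap ℚ_[p] (PadicAlgCl p)).comp PadicInt.Coe.ringHom) =
          Polynomial.X ^ 2
            - Polynomial.C ((D t).ι ⟨(qExpansion 1 ⇑(D t).g).coeff ((Rat.HeightOneSpectrum.primesEquiv v : Nat.Primes) : ℕ),
                coeff_mem_coeffField (D t).g _⟩) * Polynomial.X
            + Polynomial.C ((((Rat.HeightOneSpectrum.primesEquiv v : Nat.Primes) : ℕ) : PadicAlgCl p) ^ ((D t).k - 1).toNat))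
    (hrat : ∀ t : ℕ, Function.Surjective (algebraMap ℤ_[p] (padicCoeffIntegers (D t).ι))) :
    ∃ π : FramedGaloisRep ℚ (PowerSeries ℤ_[p]) 2, IsFrobeniusBranchGaloisLattice W p x D π := by
  classical
  set Λ := PowerSeries ℤ_[p] with hΛ
  set K := FractionRing (PowerSeries ℤ_[p]) with hK
  set algK : PowerSeries ℤ_[p] →+* K := algebraMap (PowerSeries ℤ_[p]) K with halgK
  have hinj : Function.Injective algK := IsFractionRing.injective (PowerSeries ℤ_[p]) K
  -- Wiles' representation over `K`
  set ΨK := Ψ.map algK with hΨK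
  have hx₀K : algK (Ψ.x r₀ s₀) ≠ 0 := fun h => hx₀ (hinj (by rw [h, map_zero]))
  set uK : Kˣ := (isUnit_iff_ne_zero.mpr hx₀K).unit with huKdef
  have huK : (uK : K) = ΨK.x r₀ s₀ := (isUnit_iff_ne_zero.mpr hx₀K).unit_spec
  set ρK : absoluteGaloisGroup ℚ →* Matrix (Fin 2) (Fin 2) K := ΨK.toRep r₀ s₀ uK huK with hρK
  have h00 : ∀ g, ρK g 0 0 = algK (Ψ.a g) := fun g => ΨK.toRep_apply_zero_zero r₀ s₀ uK huK g
  have h11 : ∀ g, ρK g 1 1 = algK (Ψ.d g) := fun g => ΨK.toRep_apply_one_one r₀ s₀ uK huK g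
  have h10 : ∀ g, ρK g 1 0 = algK (Ψ.x r₀ g) := fun g => ΨK.toRep_apply_one_zero r₀ s₀ uK huK g
  have h01 : ∀ g, algK (Ψ.x r₀ s₀) * ρK g 0 1 = algK (Ψ.x g s₀) := fun g => by
    rw [ΨK.toRep_apply_zero_one r₀ s₀ uK huK g]
    change (ΨK.x r₀ s₀) * (ΨK.x g s₀ * ↑uK⁻¹) = ΨK.x g s₀
    rw [← huK, mul_comm, mul_assoc, Units.inv_mul, mul_one]
  have hxx : ∀ g h, ∃ r : PowerSeries ℤ_[p], ρK g 0 1 * ρK h 1 0 = algK r := fun g h =>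
    ⟨Ψ.x g h, ΨK.toRep_apply_zero_one_mul_apply_one_zero r₀ s₀ uK huK g h⟩
  -- the integral continuous frame (G3)
  obtain ⟨π, U, hπ⟩ := TelescopeBranchIntegralFrame.exists_framedRep_powerSeries_padicInt (K := K) ρK (Ψ.x r₀ s₀) hx₀ Ψ.a Ψ.d
    (fun g => Ψ.x r₀ g) (fun g => Ψ.x g s₀) h00 h11 h10 h01 hxx ha hd hcl hcr
  -- trace and determinant of `ρK`, hence the characteristic polynomial of `π`
  have htrK : ∀ g, (ρK g).trace = algK (Ψ.tr g) := fun g => by rw [ΨK.trace_toRep, WilesPseudoRep.tr_map]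
  have hdetK : ∀ g, (ρK g).det = algK (Ψ.det g) := fun g => by
    rw [ΨK.det_toRep, WilesPseudoRep.det_apply, WilesPseudoRep.det_apply, map_sub, map_mul]; rfl
  have hchar : ∀ σ, (((π σ : GL (Fin 2) (PowerSeries ℤ_[p])) : Matrix (Fin 2) (Fin 2) (PowerSeries ℤ_[p]))).charpoly =
      Polynomial.X ^ 2 - Polynomial.C (Ψ.tr σ) * Polynomial.X + Polynomial.C (Ψ.det σ) := by
    intro σ
    apply Polynomial.map_injective algK hinj
    rw [TelescopeBranchIntegralFrame.charpoly_map_eq_of_map_eq_units_conj _ _ U (hπ σ), Matrix.charpoly_fin_two, htrK, hdetK,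
      map_quadratic]
  -- `2 ∈ Kˣ`
  have h2K : IsUnit (2 : K) := by
    obtain ⟨w, hw⟩ := TelescopeBranchGluedPseudoRep.isUnit_two hp
    have : (2 : K) = algK (PowerSeries.C (2 : ℤ_[p])) := by
      rw [show (PowerSeries.C (2 : ℤ_[p])) = 2 from map_ofNat _ 2, map_ofNat]
    rw [this, ← hw]
    exact ((Units.isUnit w).map PowerSeries.C).map algK
  have hadj := ΨK.adjoin_range_toRep_eq_top r₀ s₀ uK huK h2K
  refine ⟨π, ?_, ?_, ?_, hrat⟩
  · -- (F-unr)
    intro v hv 𝔓 h𝔓 σ hσ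
    have htr' : ∀ g, (ρK (g * σ)).trace = (ρK g).trace := fun g => by rw [htrK, htrK, hunr v hv 𝔓 h𝔓 σ hσ g]
    have hρσ : ρK σ = 1 := TelescopeBranchWilesRepAlgebra.map_eq_one_of_forall_trace_mul_eq ρK hadj σ htr'
    exact Units.val_eq_one.mp (TelescopeBranchIntegralFrame.eq_one_of_map_eq_units_conj_one _ _ U (hπ σ) hρσ)
  · -- (F-fib₀)
    intro v hv hvp 𝔓 h𝔓 σ hσ
    change ((((π σ : GL (Fin 2) (PowerSeries ℤ_[p])) : Matrix (Fin 2) (Fin 2) (PowerSeries ℤ_[p]))).map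
      (PowerSeries.constantCoeff (R := ℤ_[p]))).charpoly = _
    rw [Matrix.charpoly_map, hchar, map_quadratic]
    exact hfib0 v hv hvp 𝔓 h𝔓 σ hσ
  · -- (F-fib_t)
    intro t ht v hv hvp 𝔓 h𝔓 σ hσ
    rw [Matrix.charpoly_map, hchar, map_quadratic]
    exact hfibt t ht v hv hvp 𝔓 h𝔓 σ hσ

/-- **The Frobenius-currency Galois lattice EXISTS on the chart (brick G5).** For `W/ℚ` globally minimal, `p` an odd prime of multiplicative
reduction, and an analytic chart `IsPNewBranchAnalyticChart W p ι j A x D` of the `p`-new branch with `ℚ_p`-rational members, there is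
`π : Γ_ℚ →ₜ* GL₂(ℤ_p⟦X⟧)` with `IsFrobeniusBranchGaloisLattice W p x D π` — Hida 1986 Thm. 2.1 (2.2b), (2.2c)∘(2.1b) read on the chart,
obtained by Wiles' interpolation of pseudo-representations (no Hecke algebra `𝕀`, no residual irreducibility: Cell C is Eisenstein).
[cite: Hida1986, Thm. 2.1 (2.2b) (2.2c), §2 (2.1b)] [cite: Wiles1988, §2.2] [cite: Hida2000, §2.2.1, Prop. 2.16, Lemma 3.28] -/
theorem exists_frobeniusBranchGaloisLattice_of_chart (W : WeierstrassCurve ℚ) [W.IsElliptic] [W.IsGloballyMinimal] (hp : 2 < p)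
    (hmult : W.HasMultiplicativeReductionAtPrime p) {ι : PadicAlgCl p ≃+* ℂ} {j : ℤ_[p] →+* unrIntegers p}
    (hj : ∀ z : ℤ_[p], ((j z : unrIntegers p) : ℂ_[p]) = algebraMap ℚ_[p] ℂ_[p] (z : ℚ_[p]))
    {A : ℕ → UnrSeries p} {x : ℕ → ℤ_[p]} {D : ℕ → Skinner2016.HidaCongruentForm W p 1}
    (hchart : IsPNewBranchAnalyticChart W p ι j A x D)
    (hrat : ∀ t : ℕ, Function.Surjective (algebraMap ℤ_[p] (padicCoeffIntegers (D t).ι))) :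
    ∃ π : FramedGaloisRep ℚ (PowerSeries ℤ_[p]) 2, IsFrobeniusBranchGaloisLattice W p x D π := by
  obtain ⟨c, Ψ, r₀, s₀, hx₀, ha, hd, hcl, hcr, hunr, hfib0, hfibt⟩ :=
    TelescopeBranchGluedPseudoRep.exists_gluedPseudoRep W hp hmult hj hchart hrat
  exact isFrobeniusBranchGaloisLattice_of_pseudoRep W hp x D Ψ r₀ s₀ hx₀ ha hd hcl hcr hunr hfib0 hfibt hrat

/-- **THE KERNEL BRIDGE `T-An-2ʳ ⊢ T-An-2ᶠ` (fact level, BY NAME).** Binders and the analytic conjuncts (chart, (an∞), (an_t)) pass through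
unchanged; the Galois lattice `π` with `IsFrobeniusBranchGaloisLattice W p x D π` is CONSTRUCTED on the same `(x, D)` by
`exists_frobeniusBranchGaloisLattice_of_chart` from (R-rat) = (F-rat). Hence T-An-2ʳ ⟹ T-An-2ᶠ ⟹ T-An-2ᴴ ⟹ T-An-2ᵍ in the tree
(g24 p777078, p775285). [cite: Hida1986, Thm. 2.1 (2.2b) (2.2c), §2 (2.1b), Cor. 1.3, Cor. 1.4] [cite: Wiles1988, §2.2]
[cite: Castella2018, §4 (4.1)] [cite: Castella2020JIMJ, Def. 2.10, Thm. 2.11] -/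
theorem frobeniusGaloisLattice_of_rationalMembers (h : hida1986_castella2020_exists_rationalMembers_on_pNewBranchChart) :
    hida1986_castella2020_exists_frobeniusGaloisLattice_on_pNewBranchChart := by
  intro p _ ι W _ _ K _ _ 𝔭 κ γ _ N _ f hf hN hp hmult hK hodd hdisc hHeeg hsplit hp𝔭 h𝔭 hanti j hj
  obtain ⟨A, x, D, hchart, hL, hrat⟩ := h ι W K 𝔭 κ γ hf hN hp hmult hK hodd hdisc hHeeg hsplit hp𝔭 h𝔭 hanti j hj
  obtain ⟨π, hπ⟩ := exists_frobeniusBranchGaloisLattice_of_chart W hp hmult hj hchart hrat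
  exact ⟨A, x, D, hchart, hL, π, hπ⟩

end Summit.BirchSwinnertonDyer.BirchSwinnertonDyer.Theorems.TelescopeBranchFrobeniusLatticeOfChart

end
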